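/-
Copyright: statement-level skeleton of a published paper (lit-balaban cell, Phase-2 proof seat p39 gen 16). No proof claims
beyond what the kernel checks below.
-/
import Literature.MathematicalPhysics.QuantumFieldTheory.Balaban1983to89.B3WT228Left

/-!
# B3 — T. Bałaban, *(Higgs)₂,₃ quantum fields in a finite volume. III. Renormalization*, CMP **88** (1983) 411–445
[Balaban1983Higgs3], p. 431 [PDF 21] L20: **"differentiating (2.24) to higher order in A"** — the Ward–Takahashi identities of
ALL ORDERS in the vector field, ON THE CONCRETE LATTICE MODEL (left members: the Gaussian-integral identities), in arbitrary
directions `B₁,…,Bₙ`, at every background `A`, in the presence of every admissible gauge-invariant `F`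

statement-level skeleton of published theorems with citation tags; proofs where landed; nothing here is a claim about
the Yang–Mills mass gap

PDF held: `paper:balaban1983-higgs-2-3-quantum-fields-finite-volume` (journal page = PDF page + 410); pp. 430–431 [PDF 20–21] read
(`lit read`, p0020.txt/p0021.txt; displays (2.23)–(2.28) as on the ×4 renders
`run/shared/lean/pub/pub-balaban/b2b-balaban-ref1/pages/1983-cmp88-higgs23-III/1983-cmp88-higgs23-III-p020-x4.png`, `…-p021-x4.png`).

CITATION HEADER (lean-in-tree rule).  Part of the lit-balaban TYPED SKELETON (HOME `run/shared/lean/pub/lit-balaban/`), PHASE 2,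
proof seat p39 (generation 16).  Row **B3.Eq2.26-2.28** of `HOME/lit-balaban-r15/ROWS-B3.md` (fold owner r15; head `proved`,
front-loaded SCOPE clause v1.164: *"not claimed: p. 431 prose ‹higher order in A›"* — the item this file addresses).  Sequel of
this seat's `B3WT223Instance` ((2.23) `eq223`), `B3WT224Instance` ((2.24) for every background `A` and every admissible `F`,
`eq224`; the pairing `pairDA = ⟨D^η_Aφ, ∂^ηλqU(A)φ⟩`), `B3WT226Pairings` (the current `pairJ = ⟨D^η_Aφ, BqU(A)φ⟩`, its `A = 0`
forms `curJ`/`locQ`/`derQ`, the derivative term `pairDAdot`, `inner_q_self`, `norm_q_apply_le`, `norm_U_apply`),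
`B3WT226Derivative`/`B3WT228Left` (FIRST order in `A`: (2.26)/(2.28) left members `eq226_deriv`, `eq226F_deriv`); all BY NAME.

THE PRINTED TEXT (verbatim, pp. 430–431).  *"Taking a first order differential with respect to λ we get:
∫dφ exp[−½⟨φ,(−Δ^η_A + M²)φ⟩]F(φ)⟨D^η_Aφ, ∂^ηλqφ⟩ = 0. (2.24)  Now differentiating (2.24) with respect to A, connecting the
vertices by properly localized propagators, and calculating the Gaussian integrals […], we get a set of Ward-Takahashi
identities. … Taking other functions F, or differentiating (2.24) to higher order in A, we can get all necessary Ward-Takahashi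
identities."*  The print draws the first-order pictures (2.27)/(2.28) only; the higher-order identities are asserted in prose.

WHAT THIS FILE PROVES (theorems; definitions with bodies = bookkeeping of the integrands; no named fact, no `sorry`).
The lattice model of `B3WT223Instance`/`B3WT224Instance`: fields `φ : T^{(j)} → R^N`, Lebesgue `dφ`, `U(A) = exp(qηeA)` (B1 (1.7)),
weight `exp[−½⟨φ,(−Δ^η_A+M²)φ⟩]` (`weight`), `η^d = w`, lattice factor `c`, mass `M²`, charge data `C = (e, q)`.
* §1 **Bond atoms.**  Since `U` is unitary and `⟪u, qu⟫ = 0`, every pairing met when (2.24) is differentiated in `A` is a bond sum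
  of the atoms `X_{b,m}(A,φ) := ⟪φ(b₋), q^m U(A_b)φ(b₊)⟫` (`atomX`): `⟨D^η_Aφ, BqU(A)φ⟩ = −Σ_b η^d c B_b X_{b,1}` (`ev_pJ`), and along
  `A + sB`, `d/ds X_{b,m} = ηeB_b·X_{b,m+1}` (`hasDerivAt_atomX`; `d/ds U(a+sg) = ηeg·qU(a+sg)`, `hasDerivAt_U_aff`); `|X_{b,m}| ≤ sup|φ|²`.
* §2 **The algebra of integrands** = the polynomial ring `MvPolynomial (PBond × ℕ) ℝ` in the atoms, evaluated at `(A, φ)` by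
  `ev`; the differentiation in the direction `B` is the DERIVATION `DB B` (`MvPolynomial.mkDerivation`, `X_{b,m} ↦ ηeB_b·X_{b,m+1}`):
  **`hasDerivAt_ev`** (`d/ds ev_{A+sB}(p) = ev_{A+sB}(DB B p)`, structural induction), `continuous_ev`, and the growth bound
  `|ev_A(p)(φ)| ≤ K(1 + sup|φ|)^d` uniform in the background (`exists_bound_ev`).
* §3 **One differentiation in A** of an integrand `e^{−½⟨φ,(−Δ_A+M²)φ⟩}·ev_A(p)`: `d/ds e^{−½⟨φ,(−Δ_{A+sB}+M²)φ⟩} = −cηe·e^{…}⟨D_{A+sB}φ,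
  BqU(A+sB)φ⟩` (`hasDerivAt_weight_aff`, the source of the current insertions), hence the recursion
  **`step B p = −cηe·J_B·p + DB B p`** (`J_B = pJ B`): `d/ds[weight(A+sB)·ev_{A+sB}(p)] = weight(A+sB)·ev_{A+sB}(step B p)`
  (`hasDerivAt_weight_mul_ev`), so the n-th `s`-derivative is `weight·ev((step B)^n p)` (`iteratedDeriv_weight_mul_ev`).
* §4 **The analytic step** (the printed mechanism of (2.24)/(2.26), once and for all): if `∫dφ e^{−½⟨φ,(−Δ_A+M²)φ⟩}F(φ)ev_A(p) = 0`
  for EVERY background `A`, then the same holds for `step B p`, every `B` (`integral_step_eq_zero`: dominated differentiation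
  under the integral sign at `s = 0` of the identically vanishing family `s ↦ ∫…(A+sB)…`, Gaussian majorant
  `B3WT224Instance.integrable_explin_mul_gauss` absorbing `(1+sup|φ|)^d·Ke^{κ sup|φ|}`, and
  `B3Sect2StatementsPart2.deriv_eq_zero_of_invariant` BY NAME).
* §5 **ALL ORDERS**: with `Pseq λ [Bₙ,…,B₁] = step Bₙ (… (step B₁ (pDA λ)))` (`pDA λ = J_{∂^ηλ}`, `ev = ⟨D_Aφ,∂λqU(A)φ⟩`, `ev_pDA`),
  **`eq224_allOrders`**: `∫dφ e^{−½⟨φ,(−Δ^η_A+M²)φ⟩}F(φ)·ev_A(Pseq λ [Bₙ,…,B₁])(φ) = 0` for every `n`, all directions, every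
  background `A`, every continuous gauge-invariant `F` of exponential-linear growth (`η^d > 0`, `M² > 0`, `cηe ≠ 0`; base case =
  `B3WT224Instance.eq224`); `Pseq` IS the iterated directional derivative of the (2.24) integrand (`deriv_integrand_Pseq`); in one
  direction **`eq224_iteratedDeriv`**: `∫dφ (dⁿ/dsⁿ|_{s=0}[e^{−½⟨φ,(−Δ_{A+sB}+M²)φ⟩}⟨D_{A+sB}φ, ∂λqU(A+sB)φ⟩])·F(φ) = 0`, and at
  `A = 0` (`eq224_iteratedDeriv_zero`, `eq224_allOrders_zero`, normalized `…_mean`).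
* §6 **Order one is (2.26)/(2.28)**: `ev_A(DB B (pDA λ)) = pairDAdot` (`ev_DB_pDA`), `ev_A(step B (pDA λ)) = −cηe·J·P + Ṗ`
  (`ev_step_pDA`); at `A = 0` the order-1 integrand is LETTER FOR LETTER the integrand of `B3WT228Left.eq226F_deriv`
  (`ev_step_pDA_zero`; order one of `eq224_allOrders_zero` IS that landed theorem, cited not restated).
* §7 **Order two written out** (the first identity the print leaves to the words *"higher order in A"*): `Pseq λ [B₂,B₁] =
  (cηe)²J₂J₁P − cηe(J₂P⁽¹⁾ + J₁⁽²⁾P + J₁P⁽²⁾) + P⁽¹²⁾` in the currents `cur m a = −Σ_b η^d c a_b X_{b,m}` (`Pseq_two`; `DB_cur`), and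
  the explicit second-order identity at `A = 0` in bond sums `Σ_b η^d c a_b⟪φ(b₋), q^mφ(b₊)⟫` (`eq224_secondOrder_zero`).
HONEST SCOPE: LEFT members (Gaussian-integral identities) on the model torus, every order; the RIGHT members (Wick evaluation into
products of propagators `C^η_{M²}`, the pictures — printed for order one only, (2.27)/(2.28), and drawn in this seat's
`B3WT228Graphs`/`B3WT228Phi2Graphs`) are not drawn here for `n ≥ 2`.  Mathlib + the cited tree files only; standard axioms.
Unit `lit-balaban-p39-g16` (Phase-2 proof seat p39, gen 16), HOME `run/shared/lean/pub/lit-balaban/`, 2026-08-22.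

References: [Balaban1983Higgs3] T. Bałaban, CMP 88 (1983) 411–445, (2.23)–(2.28) pp. 430–431; [Balaban1982Higgs1] T. Bałaban,
CMP 85 (1982) 603–636, (1.7) p. 605 (`U(A) = exp(qεeA)`, `q* = −q`, `|q| ≤ 1`).
-/

noncomputable section

open scoped BigOperators InnerProductSpace

namespace Literature.MathematicalPhysics.QuantumFieldTheory.Balaban1983to89.B3WT224HigherOrder

open _root_.MeasureTheory
open LatticeFieldCalculus B3WT223Instance B3WT224Instance B3WT226Pairings

variable {P : Params} {j N : ℕ} (C : HiggsLattice.ChargeData N) (η w c M2 : ℝ)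

/-! ## §1 Bond atoms `X_{b,m}(A,φ) = ⟪φ(b₋), q^m U(A_b)φ(b₊)⟫` -/

/-- `q^{m+1}v = q^m(qv)`. [cite: Balaban1982Higgs1, (1.7) p.605] -/
theorem qpow_succ_apply (m : ℕ) (v : EuclideanSpace ℝ (Fin N)) : (C.q ^ (m + 1)) v = (C.q ^ m) (C.q v) := by
  rw [pow_succ]
  rfl

/-- `|q^m v| ≤ |v|` (B1 p. 605: `|q| ≤ 1`). [cite: Balaban1982Higgs1, (1.7) p.605] -/
theorem norm_qpow_apply_le (m : ℕ) (v : EuclideanSpace ℝ (Fin N)) : ‖(C.q ^ m) v‖ ≤ ‖v‖ := by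
  induction m generalizing v with
  | zero => simp
  | succ m ih => rw [qpow_succ_apply]; exact (ih _).trans (norm_q_apply_le C v)

/-- THE BOND ATOMS of the `A`-differentiated (2.24): `X_{b,m}(A,φ) := ⟪φ(b₋), q^m U(A_b)φ(b₊)⟫` for a bond `b = ⟨b₋,b₊⟩` and `m ∈ ℕ`
(`U(A) = exp(qηeA)` of B1 (1.7)); every pairing obtained by differentiating (2.24) with respect to `A` is a bond sum of these.
[cite: Balaban1983Higgs3, (2.24) p.430; (2.26) p.431] -/
def atomX (A : VecField P j ℝ) (φ : Cfg P j N) : PBond P j × ℕ → ℝ :=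
  fun i => ⟪φ i.1.src, (C.q ^ i.2) (C.U η (A i.1) (φ i.1.tgt))⟫_ℝ

/-- the atom, unfolded. [cite: Balaban1983Higgs3, (2.24) p.430] -/
theorem atomX_apply (A : VecField P j ℝ) (φ : Cfg P j N) (b : PBond P j) (m : ℕ) :
    atomX C η A φ (b, m) = ⟪φ b.src, (C.q ^ m) (C.U η (A b) (φ b.tgt))⟫_ℝ := rfl

/-- at `A = 0`: `X_{b,m}(0,φ) = ⟪φ(b₋), q^mφ(b₊)⟫` (`U(0) = 1`). [cite: Balaban1983Higgs3, (2.25) p.431] -/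
theorem atomX_zero (φ : Cfg P j N) (b : PBond P j) (m : ℕ) :
    atomX C η (0 : VecField P j ℝ) φ (b, m) = ⟪φ b.src, (C.q ^ m) (φ b.tgt)⟫_ℝ := by
  rw [atomX_apply, Pi.zero_apply, HiggsLattice.ChargeData.U_zero]
  rfl

/-- `|X_{b,m}(A,φ)| ≤ sup|φ|²`, uniformly in the background (`U` unitary, `|q| ≤ 1`). [cite: Balaban1983Higgs3, (2.24) p.430] -/
theorem abs_atomX_le (A : VecField P j ℝ) (φ : Cfg P j N) (i : PBond P j × ℕ) : |atomX C η A φ i| ≤ ‖φ‖ ^ 2 := by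
  obtain ⟨b, m⟩ := i
  rw [atomX_apply]
  have h1 := abs_real_inner_le_norm (φ b.src) ((C.q ^ m) (C.U η (A b) (φ b.tgt)))
  have h2 : ‖(C.q ^ m) (C.U η (A b) (φ b.tgt))‖ ≤ ‖φ‖ :=
    ((norm_qpow_apply_le C m _).trans (le_of_eq (norm_U_apply C η _ _))).trans (norm_le_pi_norm φ b.tgt)
  have h3 : ‖φ b.src‖ ≤ ‖φ‖ := norm_le_pi_norm φ b.src
  calc |⟪φ b.src, (C.q ^ m) (C.U η (A b) (φ b.tgt))⟫_ℝ| ≤ ‖φ b.src‖ * ‖(C.q ^ m) (C.U η (A b) (φ b.tgt))‖ := h1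
    _ ≤ ‖φ‖ * ‖φ‖ := mul_le_mul h3 h2 (norm_nonneg _) (norm_nonneg _)
    _ = ‖φ‖ ^ 2 := by ring

/-- `φ ↦ X_{b,m}(A,φ)` is continuous on field space. [cite: Balaban1983Higgs3, (2.24) p.430] -/
theorem continuous_atomX (A : VecField P j ℝ) (i : PBond P j × ℕ) : Continuous fun φ : Cfg P j N => atomX C η A φ i :=
  (continuous_apply i.1.src).inner
    ((C.q ^ i.2).continuous.comp ((C.U η (A i.1)).continuous.comp (continuous_apply i.1.tgt)))

/-- `d/ds U(a + sg)v = ηeg·qU(a + sg)v` for `U(a) = exp(qηea)` (B1 (1.7)), at a general base point `a`.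
[cite: Balaban1982Higgs1, (1.7) p.605] -/
theorem hasDerivAt_U_aff (a g : ℝ) (v : EuclideanSpace ℝ (Fin N)) (t : ℝ) :
    HasDerivAt (fun s : ℝ => C.U η (a + s * g) v) ((η * C.e * g) • C.q (C.U η (a + t * g) v)) t := by
  have hθ : HasDerivAt (fun s : ℝ => η * C.e * (a + s * g)) (η * C.e * g) t := by
    refine ((((hasDerivAt_id t).mul_const g).const_add a).const_mul (η * C.e)).congr_deriv ?_
    ring
  have hexp : HasDerivAt (fun u : ℝ => NormedSpace.exp (u • C.q))
      (C.q * NormedSpace.exp ((η * C.e * (a + t * g)) • C.q)) (η * C.e * (a + t * g)) :=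
    hasDerivAt_exp_smul_const' C.q _
  have hcomp := hexp.scomp t hθ
  have happ := ((ContinuousLinearMap.apply ℝ (EuclideanSpace ℝ (Fin N)) v).hasFDerivAt).comp_hasDerivAt t hcomp
  exact happ

/-- **`d/ds X_{b,m}(A+sB,φ) = ηeB_b·X_{b,m+1}(A+sB,φ)`** — differentiating an atom in the direction `B` inserts one more `q`
(and the factor `ηeB_b`): the algebraic heart of *"differentiating (2.24) to higher order in A"*.
[cite: Balaban1983Higgs3, (2.24) p.430; p.431 L20] -/
theorem hasDerivAt_atomX (A B : VecField P j ℝ) (φ : Cfg P j N) (b : PBond P j) (m : ℕ) (s : ℝ) :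
    HasDerivAt (fun t : ℝ => atomX C η (A + t • B) φ (b, m))
      ((η * C.e * B b) * atomX C η (A + s • B) φ (b, m + 1)) s := by
  have hU := hasDerivAt_U_aff C η (A b) (B b) (φ b.tgt) s
  have h1 := (C.q ^ m).hasFDerivAt.comp_hasDerivAt s hU
  have h2 := (hasDerivAt_const s (φ b.src)).inner ℝ h1
  refine (h2.congr_of_eventuallyEq (Filter.Eventually.of_forall fun t => ?_)).congr_deriv ?_
  · simp only [atomX_apply, Pi.add_apply, Pi.smul_apply, smul_eq_mul, Function.comp]
  · rw [inner_zero_left, add_zero, atomX_apply, Pi.add_apply, Pi.smul_apply, smul_eq_mul, map_smul, real_inner_smul_right,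
      qpow_succ_apply]

/-! ## §2 The algebra of integrands: polynomials in the atoms, evaluation, and the derivation `DB` -/

/-- the ring of integrands: real polynomials in the bond atoms `X_{b,m}`, `(b,m) ∈ PBond × ℕ`.
[cite: Balaban1983Higgs3, (2.24) p.430; p.431 L20] -/
abbrev WTPoly (P : Params) (j : ℕ) : Type := MvPolynomial (PBond P j × ℕ) ℝ

/-- evaluation of an integrand at the background `A` and the field `φ` (`X_{b,m} ↦ ⟪φ(b₋), q^mU(A_b)φ(b₊)⟫`).
[cite: Balaban1983Higgs3, (2.24) p.430] -/
def ev (A : VecField P j ℝ) (φ : Cfg P j N) (p : WTPoly P j) : ℝ := MvPolynomial.eval (atomX C η A φ) p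

/-- THE DIFFERENTIATION IN THE DIRECTION `B` as a derivation of the ring of integrands: `X_{b,m} ↦ ηeB_b·X_{b,m+1}`
(`hasDerivAt_atomX`), extended by the Leibniz rule. [cite: Balaban1983Higgs3, p.431 L20 ("differentiating (2.24) to higher order in A")] -/
def DB (B : VecField P j ℝ) : Derivation ℝ (WTPoly P j) (WTPoly P j) :=
  MvPolynomial.mkDerivation ℝ fun i : PBond P j × ℕ => MvPolynomial.C (η * C.e * B i.1) * MvPolynomial.X (i.1, i.2 + 1)

/-- `ev` of a constant. [cite: Balaban1983Higgs3, (2.24) p.430] -/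
@[simp] theorem ev_C (A : VecField P j ℝ) (φ : Cfg P j N) (a : ℝ) : ev C η A φ (MvPolynomial.C a) = a := by
  simp [ev]

/-- `ev` of `0`. [cite: Balaban1983Higgs3, (2.24) p.430] -/
@[simp] theorem ev_zero (A : VecField P j ℝ) (φ : Cfg P j N) : ev C η A φ 0 = 0 := by
  simp [ev]

/-- `ev` of an atom. [cite: Balaban1983Higgs3, (2.24) p.430] -/
@[simp] theorem ev_X (A : VecField P j ℝ) (φ : Cfg P j N) (i : PBond P j × ℕ) :
    ev C η A φ (MvPolynomial.X i) = atomX C η A φ i := by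
  simp [ev]

/-- `ev` is additive. [cite: Balaban1983Higgs3, (2.24) p.430] -/
@[simp] theorem ev_add (A : VecField P j ℝ) (φ : Cfg P j N) (p q : WTPoly P j) :
    ev C η A φ (p + q) = ev C η A φ p + ev C η A φ q := by
  simp [ev]

/-- `ev` is multiplicative. [cite: Balaban1983Higgs3, (2.24) p.430] -/
@[simp] theorem ev_mul (A : VecField P j ℝ) (φ : Cfg P j N) (p q : WTPoly P j) :
    ev C η A φ (p * q) = ev C η A φ p * ev C η A φ q := by
  simp [ev]

/-- `ev` of a finite sum. [cite: Balaban1983Higgs3, (2.24) p.430] -/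
theorem ev_sum {ι : Type*} (A : VecField P j ℝ) (φ : Cfg P j N) (s : Finset ι) (f : ι → WTPoly P j) :
    ev C η A φ (∑ i ∈ s, f i) = ∑ i ∈ s, ev C η A φ (f i) := by
  simp [ev, map_sum]

/-- `DB B (X_{b,m}) = ηeB_b·X_{b,m+1}`. [cite: Balaban1983Higgs3, p.431 L20] -/
theorem DB_X (B : VecField P j ℝ) (b : PBond P j) (m : ℕ) :
    DB C η B (MvPolynomial.X (b, m)) = MvPolynomial.C (η * C.e * B b) * MvPolynomial.X (b, m + 1) := by
  rw [DB, MvPolynomial.mkDerivation_X]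

/-- `DB B` kills constants. [cite: Balaban1983Higgs3, p.431 L20] -/
theorem DB_C (B : VecField P j ℝ) (a : ℝ) : DB C η B (MvPolynomial.C a) = 0 :=
  MvPolynomial.derivation_C _ a

/-- **the chain rule for integrands**: along `A + sB`, `d/ds ev_{A+sB}(p)(φ) = ev_{A+sB}(DB B p)(φ)` for every polynomial `p` in the
atoms (structural induction: constants, sums, and `p·X_{b,m}` by the product rule and `hasDerivAt_atomX`).
[cite: Balaban1983Higgs3, p.431 L20 ("differentiating (2.24) to higher order in A")] -/
theorem hasDerivAt_ev (A B : VecField P j ℝ) (φ : Cfg P j N) (p : WTPoly P j) (s : ℝ) :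
    HasDerivAt (fun t : ℝ => ev C η (A + t • B) φ p) (ev C η (A + s • B) φ (DB C η B p)) s := by
  induction p using MvPolynomial.induction_on with
  | C a =>
    simp only [ev_C, DB_C, ev_zero]
    exact hasDerivAt_const s a
  | add p q hp hq =>
    simp only [ev_add, map_add]
    exact hp.add hq
  | mul_X p i hp =>
    obtain ⟨b, m⟩ := i
    have h := hp.mul (hasDerivAt_atomX C η A B φ b m s)
    refine (h.congr_of_eventuallyEq (Filter.Eventually.of_forall fun t => ?_)).congr_deriv ?_
    · simp only [ev_mul, ev_X, Pi.mul_apply]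
    · rw [Derivation.leibniz, smul_eq_mul, smul_eq_mul, DB_X, ev_add, ev_mul, ev_mul, ev_mul, ev_C, ev_X, ev_X]
      ring

/-- `φ ↦ ev_A(p)(φ)` is continuous on field space. [cite: Balaban1983Higgs3, (2.24) p.430] -/
theorem continuous_ev (A : VecField P j ℝ) (p : WTPoly P j) : Continuous fun φ : Cfg P j N => ev C η A φ p := by
  induction p using MvPolynomial.induction_on with
  | C a => simp only [ev_C]; exact continuous_const
  | add p q hp hq => simp only [ev_add]; exact hp.add hq
  | mul_X p i hp => simp only [ev_mul, ev_X]; exact hp.mul (continuous_atomX C η A i)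

/-- **growth bound, uniform in the background**: `|ev_A(p)(φ)| ≤ K(1 + sup|φ|)^d` for some `K ≥ 0`, `d ∈ ℕ` depending on `p` only
(each atom is bounded by `sup|φ|²`). [cite: Balaban1983Higgs3, (2.24) p.430] -/
theorem exists_bound_ev (p : WTPoly P j) :
    ∃ K : ℝ, ∃ d : ℕ, 0 ≤ K ∧ ∀ (A : VecField P j ℝ) (φ : Cfg P j N), |ev C η A φ p| ≤ K * (1 + ‖φ‖) ^ d := by
  induction p using MvPolynomial.induction_on with
  | C a => exact ⟨|a|, 0, abs_nonneg a, fun A φ => by simp⟩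
  | add p q hp hq =>
    obtain ⟨K₁, d₁, hK₁, h₁⟩ := hp
    obtain ⟨K₂, d₂, hK₂, h₂⟩ := hq
    refine ⟨K₁ + K₂, d₁ + d₂, add_nonneg hK₁ hK₂, fun A φ => ?_⟩
    have ht : 1 ≤ 1 + ‖φ‖ := le_add_of_nonneg_right (norm_nonneg φ)
    have e1 : (1 + ‖φ‖) ^ d₁ ≤ (1 + ‖φ‖) ^ (d₁ + d₂) := pow_le_pow_right₀ ht (Nat.le_add_right _ _)
    have e2 : (1 + ‖φ‖) ^ d₂ ≤ (1 + ‖φ‖) ^ (d₁ + d₂) := pow_le_pow_right₀ ht (Nat.le_add_left _ _)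
    rw [ev_add]
    calc |ev C η A φ p + ev C η A φ q| ≤ |ev C η A φ p| + |ev C η A φ q| := abs_add_le _ _
      _ ≤ K₁ * (1 + ‖φ‖) ^ d₁ + K₂ * (1 + ‖φ‖) ^ d₂ := add_le_add (h₁ A φ) (h₂ A φ)
      _ ≤ K₁ * (1 + ‖φ‖) ^ (d₁ + d₂) + K₂ * (1 + ‖φ‖) ^ (d₁ + d₂) :=
          add_le_add (mul_le_mul_of_nonneg_left e1 hK₁) (mul_le_mul_of_nonneg_left e2 hK₂)
      _ = (K₁ + K₂) * (1 + ‖φ‖) ^ (d₁ + d₂) := by ring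
  | mul_X p i hp =>
    obtain ⟨K, d, hK, h⟩ := hp
    refine ⟨K, d + 2, hK, fun A φ => ?_⟩
    rw [ev_mul, ev_X, abs_mul]
    have ha := abs_atomX_le C η A φ i
    have hsq : ‖φ‖ ^ 2 ≤ (1 + ‖φ‖) ^ 2 := pow_le_pow_left₀ (norm_nonneg _) (by linarith [norm_nonneg φ]) 2
    calc |ev C η A φ p| * |atomX C η A φ i| ≤ K * (1 + ‖φ‖) ^ d * (1 + ‖φ‖) ^ 2 :=
          mul_le_mul (h A φ) (ha.trans hsq) (abs_nonneg _) (by positivity)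
      _ = K * (1 + ‖φ‖) ^ (d + 2) := by ring

/-! ## §3 The currents as polynomials; one differentiation in `A` of a weighted integrand -/

/-- THE CURRENTS as integrands: `cur m a := −Σ_b η^d c a_b X_{b,m}` for a bond function `a` and `m ∈ ℕ` — at `m = 1`, `a = B` this
evaluates to the current `⟨D^η_Aφ, BqU(A)φ⟩` of (2.24)/(2.26) (`ev_pJ`), and `DB` maps `cur m a` to `cur (m+1) (ηeB·a)` (`DB_cur`).
[cite: Balaban1983Higgs3, (2.26) p.431] -/
def cur (m : ℕ) (a : PBond P j → ℝ) : WTPoly P j :=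
  ∑ b : PBond P j, MvPolynomial.C (-(w * c * a b)) * MvPolynomial.X (b, m)

/-- `J_B := cur 1 B`, the integrand of the current `⟨D^η_Aφ, BqU(A)φ⟩`. [cite: Balaban1983Higgs3, (2.26) p.431] -/
def pJ (B : VecField P j ℝ) : WTPoly P j := cur w c 1 B

/-- `P_λ := J_{∂^ηλ}`, the integrand of the (2.24)-pairing `⟨D^η_Aφ, ∂^ηλqU(A)φ⟩`. [cite: Balaban1983Higgs3, (2.24) p.430] -/
def pDA (lam : Site P j → ℝ) : WTPoly P j := pJ w c (grad c lam)

/-- `ev_A(cur m a)(φ) = −Σ_b η^d c a_b⟪φ(b₋), q^mU(A_b)φ(b₊)⟫`. [cite: Balaban1983Higgs3, (2.26) p.431] -/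
theorem ev_cur (A : VecField P j ℝ) (φ : Cfg P j N) (m : ℕ) (a : PBond P j → ℝ) :
    ev C η A φ (cur w c m a) = ∑ b : PBond P j, -(w * c * a b) * ⟪φ b.src, (C.q ^ m) (C.U η (A b) (φ b.tgt))⟫_ℝ := by
  rw [cur, ev_sum]
  refine Finset.sum_congr rfl fun b _ => ?_
  rw [ev_mul, ev_C, ev_X, atomX_apply]

/-- at `A = 0`: `ev_0(cur m a)(φ) = −Σ_b η^d c a_b⟪φ(b₋), q^mφ(b₊)⟫`. [cite: Balaban1983Higgs3, (2.26) p.431] -/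
theorem ev_cur_zero (φ : Cfg P j N) (m : ℕ) (a : PBond P j → ℝ) :
    ev C η (0 : VecField P j ℝ) φ (cur w c m a) = ∑ b : PBond P j, -(w * c * a b) * ⟪φ b.src, (C.q ^ m) (φ b.tgt)⟫_ℝ := by
  rw [cur, ev_sum]
  refine Finset.sum_congr rfl fun b _ => ?_
  rw [ev_mul, ev_C, ev_X, atomX_zero]

/-- **`DB B (cur m a) = cur (m+1) (ηeB·a)`**: differentiating a current inserts a `q` and the factor `ηeB_b` bondwise.
[cite: Balaban1983Higgs3, p.431 L20] -/
theorem DB_cur (B : VecField P j ℝ) (m : ℕ) (a : PBond P j → ℝ) :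
    DB C η B (cur w c m a) = cur w c (m + 1) (fun b => η * C.e * B b * a b) := by
  rw [cur, cur, map_sum]
  refine Finset.sum_congr rfl fun b _ => ?_
  rw [Derivation.leibniz, DB_C, smul_zero, add_zero, smul_eq_mul, DB_X, ← mul_assoc, ← MvPolynomial.C_mul]
  congr 2
  ring

/-- **the current of (2.24)/(2.26) is a bond sum of atoms**: `ev_A(J_B)(φ) = ⟨D^η_Aφ, BqU(A)φ⟩` — because
`⟪U(A_b)φ(b₊), qU(A_b)φ(b₊)⟫ = 0` (`q* = −q`), only `−η^dcB_b⟪φ(b₋), qU(A_b)φ(b₊)⟫` survives in each bond term.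
[cite: Balaban1983Higgs3, (2.26) p.431] -/
theorem ev_pJ (A B : VecField P j ℝ) (φ : Cfg P j N) : ev C η A φ (pJ w c B) = pairJ C η w c A B φ := by
  rw [pJ, ev_cur, pairJ]
  refine Finset.sum_congr rfl fun b _ => ?_
  have h0 := inner_q_self C (C.U η (A b) (φ b.tgt))
  simp only [covDerivScalar, HiggsLattice.ChargeData.Urep_apply, real_inner_smul_left, real_inner_smul_right, inner_sub_left,
    pow_one]
  rw [h0]
  ring

/-- `ev_A(P_λ)(φ) = ⟨D^η_Aφ, ∂^ηλqU(A)φ⟩`, the pairing of (2.24). [cite: Balaban1983Higgs3, (2.24) p.430] -/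
theorem ev_pDA (A : VecField P j ℝ) (lam : Site P j → ℝ) (φ : Cfg P j N) :
    ev C η A φ (pDA w c lam) = pairDA C η w c A lam φ := by
  rw [pDA, ev_pJ, ← pairDA_eq_pairJ]

/-- the covariant derivative in the background `A + sB`, unfolded. [cite: Balaban1983Higgs3, (2.24) p.430] -/
theorem covDerivScalar_aff (A B : VecField P j ℝ) (φ : Cfg P j N) (b : PBond P j) (s : ℝ) :
    covDerivScalar c (C.Urep η) (A + s • B) φ b = c • (C.U η (A b + s * B b) (φ b.tgt) - φ b.src) := by
  simp only [covDerivScalar, HiggsLattice.ChargeData.Urep_apply, Pi.add_apply, Pi.smul_apply, smul_eq_mul]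

/-- `d/ds (D^η_{A+sB}φ)(b) = c·ηeB_b·qU(A_b+sB_b)φ(b₊)`. [cite: Balaban1983Higgs3, (2.26) p.431] -/
theorem hasDerivAt_covDerivScalar_aff (A B : VecField P j ℝ) (φ : Cfg P j N) (b : PBond P j) (t : ℝ) :
    HasDerivAt (fun s : ℝ => covDerivScalar c (C.Urep η) (A + s • B) φ b)
      (c • ((η * C.e * B b) • C.q (C.U η (A b + t * B b) (φ b.tgt)))) t := by
  have h := ((hasDerivAt_U_aff C η (A b) (B b) (φ b.tgt) t).sub_const (φ b.src)).const_smul c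
  exact h.congr_of_eventuallyEq (Filter.Eventually.of_forall fun s => covDerivScalar_aff C η c A B φ b s)

/-- the current in the background `A + tB`, unfolded. [cite: Balaban1983Higgs3, (2.26) p.431] -/
theorem pairJ_aff (A B : VecField P j ℝ) (φ : Cfg P j N) (t : ℝ) :
    pairJ C η w c (A + t • B) B φ =
      ∑ b : PBond P j, w * ⟪covDerivScalar c (C.Urep η) (A + t • B) φ b, (B b) • C.q (C.U η (A b + t * B b) (φ b.tgt))⟫_ℝ := by
  unfold pairJ
  simp only [Pi.add_apply, Pi.smul_apply, smul_eq_mul]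

/-- **`d/ds ⟨φ,(−Δ^η_{A+sB}+M²)φ⟩ = 2cηe·⟨D^η_{A+sB}φ, BqU(A+sB)φ⟩`** at a general background (the `A = 0` case is
`B3WT226Pairings.hasDerivAt_quadForm_lin`). [cite: Balaban1983Higgs3, (2.26) p.431] -/
theorem hasDerivAt_quadForm_aff (A B : VecField P j ℝ) (φ : Cfg P j N) (t : ℝ) :
    HasDerivAt (fun s : ℝ => quadForm C η w c M2 (A + s • B) φ) ((2 * (c * η * C.e)) * pairJ C η w c (A + t • B) B φ) t := by
  unfold quadForm covLaplaceForm
  have hsum : HasDerivAt (fun s : ℝ => ∑ b : PBond P j, w * ‖covDerivScalar c (C.Urep η) (A + s • B) φ b‖ ^ 2)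
      (∑ b : PBond P j, w * (2 * ⟪covDerivScalar c (C.Urep η) (A + t • B) φ b,
        c • ((η * C.e * B b) • C.q (C.U η (A b + t * B b) (φ b.tgt)))⟫_ℝ)) t :=
    HasDerivAt.fun_sum fun b _ => (hasDerivAt_covDerivScalar_aff C η c A B φ b t).norm_sq.const_mul w
  refine (hsum.add_const (M2 * massForm w φ)).congr_deriv ?_
  rw [pairJ_aff, Finset.mul_sum]
  refine Finset.sum_congr rfl fun b _ => ?_
  rw [real_inner_smul_right, real_inner_smul_right, real_inner_smul_right]
  ring

/-- **`d/ds exp[−½⟨φ,(−Δ^η_{A+sB}+M²)φ⟩] = −cηe·exp[…]·⟨D^η_{A+sB}φ, BqU(A+sB)φ⟩`** — differentiating the weight inserts a current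
(the source of the first term of (2.26), now at every background). [cite: Balaban1983Higgs3, (2.26) p.431] -/
theorem hasDerivAt_weight_aff (A B : VecField P j ℝ) (φ : Cfg P j N) (t : ℝ) :
    HasDerivAt (fun s : ℝ => weight C η w c M2 (A + s • B) φ)
      (-(c * η * C.e) * (weight C η w c M2 (A + t • B) φ * pairJ C η w c (A + t • B) B φ)) t := by
  unfold weight
  refine (((hasDerivAt_quadForm_aff C η w c M2 A B φ t).const_mul (-(1 / 2 : ℝ))).exp).congr_deriv ?_
  ring

/-- **THE RECURSION of "differentiating (2.24) with respect to A"**: `step B p := −cηe·J_B·p + DB B p` — one differentiation in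
the direction `B` of the weighted integrand `e^{−½⟨φ,(−Δ_A+M²)φ⟩}·ev_A(p)` produces the current insertion `−cηe·J_B·p` (from the
weight) plus the differentiated integrand `DB B p`. [cite: Balaban1983Higgs3, p.431 L20; (2.26) p.431] -/
def step (B : VecField P j ℝ) (p : WTPoly P j) : WTPoly P j :=
  MvPolynomial.C (-(c * η * C.e)) * pJ w c B * p + DB C η B p

/-- `ev_A(step B p) = −cηe·⟨D_Aφ,BqU(A)φ⟩·ev_A(p) + ev_A(DB B p)`. [cite: Balaban1983Higgs3, (2.26) p.431] -/
theorem ev_step (A B : VecField P j ℝ) (φ : Cfg P j N) (p : WTPoly P j) :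
    ev C η A φ (step C η w c B p) = -(c * η * C.e) * pairJ C η w c A B φ * ev C η A φ p + ev C η A φ (DB C η B p) := by
  rw [step, ev_add, ev_mul, ev_mul, ev_C, ev_pJ]

/-- **one differentiation in `A` of a weighted integrand**:
`d/ds [e^{−½⟨φ,(−Δ_{A+sB}+M²)φ⟩}·ev_{A+sB}(p)(φ)] = e^{−½⟨φ,(−Δ_{A+sB}+M²)φ⟩}·ev_{A+sB}(step B p)(φ)`.
[cite: Balaban1983Higgs3, p.431 L20; (2.26) p.431] -/
theorem hasDerivAt_weight_mul_ev (A B : VecField P j ℝ) (φ : Cfg P j N) (p : WTPoly P j) (t : ℝ) :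
    HasDerivAt (fun s : ℝ => weight C η w c M2 (A + s • B) φ * ev C η (A + s • B) φ p)
      (weight C η w c M2 (A + t • B) φ * ev C η (A + t • B) φ (step C η w c B p)) t := by
  refine ((hasDerivAt_weight_aff C η w c M2 A B φ t).mul (hasDerivAt_ev C η A B φ p t)).congr_deriv ?_
  rw [ev_step]
  ring

/-- **the n-th derivative in one direction**: `dⁿ/dsⁿ [e^{−½⟨φ,(−Δ_{A+sB}+M²)φ⟩}·ev_{A+sB}(p)] = e^{…}·ev_{A+sB}((step B)ⁿ p)`.
[cite: Balaban1983Higgs3, p.431 L20 ("differentiating (2.24) to higher order in A")] -/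
theorem iteratedDeriv_weight_mul_ev (A B : VecField P j ℝ) (φ : Cfg P j N) (p : WTPoly P j) (n : ℕ) :
    iteratedDeriv n (fun s : ℝ => weight C η w c M2 (A + s • B) φ * ev C η (A + s • B) φ p) =
      fun s : ℝ => weight C η w c M2 (A + s • B) φ * ev C η (A + s • B) φ ((step C η w c B)^[n] p) := by
  induction n with
  | zero => simp
  | succ n ih =>
    rw [iteratedDeriv_succ, ih]
    funext s
    rw [Function.iterate_succ_apply']
    exact (hasDerivAt_weight_mul_ev C η w c M2 A B φ ((step C η w c B)^[n] p) s).deriv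

/-! ## §4 The analytic step: an identity holding at every background survives one more differentiation in `A` -/

/-- `(1 + t)^d ≤ e^{dt}` for `t ≥ 0` (from `1 + t ≤ e^t`). [folklore] -/
private theorem one_add_pow_le_exp (t : ℝ) (ht : 0 ≤ t) (d : ℕ) : (1 + t) ^ d ≤ Real.exp (d * t) := by
  have h1 : 1 + t ≤ Real.exp t := by linarith [Real.add_one_le_exp t]
  calc (1 + t) ^ d ≤ (Real.exp t) ^ d := pow_le_pow_left₀ (by linarith) h1 d
    _ = Real.exp (d * t) := by rw [← Real.exp_nat_mul]

/-- **THE ANALYTIC STEP behind every order** (the printed mechanism of (2.24) → (2.26), once and for all): if the Gaussian integral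
`∫dφ e^{−½⟨φ,(−Δ^η_A+M²)φ⟩}F(φ)·ev_A(p)(φ)` vanishes for EVERY background `A`, then so does the integral of the differentiated
integrand `step B p`, for every direction `B` and every background — `s ↦ ∫dφ e^{−½⟨φ,(−Δ_{A+sB}+M²)φ⟩}F(φ)ev_{A+sB}(p)(φ) ≡ 0` is
differentiable at `s = 0` under the integral sign (dominated convergence, `hasDerivAt_integral_of_dominated_loc_of_deriv_le`, with
the Gaussian majorant `B3WT224Instance.integrable_explin_mul_gauss` absorbing the growth `(1+sup|φ|)^d·Ke^{κ sup|φ|}` of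
`ev(step B p)·F`, uniformly for `s` in the unit ball: `weight_le_gauss`, `exists_bound_ev`), its derivative there is the integral
of `step B p` at `A` (`hasDerivAt_weight_mul_ev`), and an identically vanishing family has derivative `0`
(`B3Sect2StatementsPart2.deriv_eq_zero_of_invariant` BY NAME).  `F` continuous of exponential-linear growth; `η^d = w > 0`, `M² > 0`.
[cite: Balaban1983Higgs3, (2.24) p.430; p.431 L20] -/
theorem integral_step_eq_zero (hw : 0 < w) (hM : 0 < M2) (F : Cfg P j N → ℝ) (hFcont : Continuous F)
    (hFgr : ∃ K κ : ℝ, ∀ φ, |F φ| ≤ K * Real.exp (κ * ‖φ‖)) (p : WTPoly P j)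
    (hp : ∀ A : VecField P j ℝ, ∫ φ, weight C η w c M2 A φ * (F φ * ev C η A φ p) = 0) (A B : VecField P j ℝ) :
    ∫ φ, weight C η w c M2 A φ * (F φ * ev C η A φ (step C η w c B p)) = 0 := by
  obtain ⟨K, κ, hK⟩ := hFgr
  have hK0 : 0 ≤ K := by
    have h := hK 0
    have h1 : (0 : ℝ) ≤ K * Real.exp (κ * ‖(0 : Cfg P j N)‖) := (abs_nonneg _).trans h
    simpa using h1
  have hK' : ∀ φ : Cfg P j N, |F φ| ≤ K * Real.exp (|κ| * ‖φ‖) := fun φ =>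
    (hK φ).trans (mul_le_mul_of_nonneg_left (Real.exp_le_exp.mpr
      (mul_le_mul_of_nonneg_right (le_abs_self κ) (norm_nonneg φ))) hK0)
  obtain ⟨K₁, d₁, hK₁, hb₁⟩ := exists_bound_ev C η (P := P) (j := j) (step C η w c B p)
  obtain ⟨K₀, d₀, hK₀, hb₀⟩ := exists_bound_ev C η (P := P) (j := j) p
  -- the family `G s = e^{−½⟨φ,(−Δ_{A+sB}+M²)φ⟩}ev_{A+sB}(p)F(φ)` and its `s`-derivative `G'`
  set G : ℝ → Cfg P j N → ℝ := fun s φ => (weight C η w c M2 (A + s • B) φ * ev C η (A + s • B) φ p) * F φ with hG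
  set G' : ℝ → Cfg P j N → ℝ := fun s φ =>
    (weight C η w c M2 (A + s • B) φ * ev C η (A + s • B) φ (step C η w c B p)) * F φ with hG'
  -- the hypothesis at the backgrounds `A + sB`: the family of integrals vanishes identically
  have hzero_s : ∀ s : ℝ, ∫ φ, G s φ = 0 := fun s => by
    have h := hp (A + s • B)
    rw [← h]
    exact integral_congr_ae (Filter.Eventually.of_forall fun φ => by simp only [hG]; ring)
  have hconst : ∀ s : ℝ, ∫ φ, G s φ = ∫ φ, G 0 φ := fun s => by rw [hzero_s s, hzero_s 0]
  -- the Gaussian majorant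
  set a : ℝ := M2 * w / 2 with ha_def
  have ha : 0 < a := by positivity
  set bound : Cfg P j N → ℝ := fun φ =>
    (K₁ * K) * (Real.exp (((d₁ : ℝ) + |κ|) * ‖φ‖) * Real.exp (-a * ∑ x : Site P j, ‖φ x‖ ^ 2)) with hbound
  have hbound_int : Integrable bound :=
    (integrable_explin_mul_gauss (P := P) (j := j) (N := N) ((d₁ : ℝ) + |κ|) ha).const_mul (K₁ * K)
  have hwt : ∀ (s : ℝ) (φ : Cfg P j N), weight C η w c M2 (A + s • B) φ ≤ Real.exp (-a * ∑ x : Site P j, ‖φ x‖ ^ 2) :=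
    fun s φ => weight_le_gauss hw.le _ φ
  have hgrow : ∀ (d : ℕ) (φ : Cfg P j N), (1 + ‖φ‖) ^ d * Real.exp (|κ| * ‖φ‖) ≤ Real.exp (((d : ℝ) + |κ|) * ‖φ‖) :=
    fun d φ => by
      rw [add_mul, Real.exp_add]
      exact mul_le_mul_of_nonneg_right (one_add_pow_le_exp ‖φ‖ (norm_nonneg _) d) (Real.exp_pos _).le
  have h_bound : ∀ᵐ φ ∂(volume : Measure (Cfg P j N)), ∀ s ∈ Metric.ball (0 : ℝ) 1, ‖G' s φ‖ ≤ bound φ := by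
    refine Filter.Eventually.of_forall fun φ s _ => ?_
    have hWpos := weight_pos (C := C) (η := η) (w := w) (c := c) (M2 := M2) (A + s • B) φ
    have e2 : ‖G' s φ‖ = weight C η w c M2 (A + s • B) φ * |ev C η (A + s • B) φ (step C η w c B p)| * |F φ| := by
      simp only [hG', Real.norm_eq_abs, abs_mul, abs_of_pos hWpos]
    rw [e2]
    calc weight C η w c M2 (A + s • B) φ * |ev C η (A + s • B) φ (step C η w c B p)| * |F φ|
        ≤ Real.exp (-a * ∑ x : Site P j, ‖φ x‖ ^ 2) * (K₁ * (1 + ‖φ‖) ^ d₁) * (K * Real.exp (|κ| * ‖φ‖)) :=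
          mul_le_mul (mul_le_mul (hwt s φ) (hb₁ _ φ) (abs_nonneg _) (Real.exp_pos _).le) (hK' φ) (abs_nonneg _)
            (by positivity)
      _ = (K₁ * K) * (((1 + ‖φ‖) ^ d₁ * Real.exp (|κ| * ‖φ‖)) * Real.exp (-a * ∑ x : Site P j, ‖φ x‖ ^ 2)) := by ring
      _ ≤ (K₁ * K) * (Real.exp (((d₁ : ℝ) + |κ|) * ‖φ‖) * Real.exp (-a * ∑ x : Site P j, ‖φ x‖ ^ 2)) :=
          mul_le_mul_of_nonneg_left (mul_le_mul_of_nonneg_right (hgrow d₁ φ) (Real.exp_pos _).le) (by positivity)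
  have h_diff : ∀ᵐ φ ∂(volume : Measure (Cfg P j N)), ∀ s ∈ Metric.ball (0 : ℝ) 1, HasDerivAt (G · φ) (G' s φ) s := by
    refine Filter.Eventually.of_forall fun φ s _ => ?_
    simp only [hG, hG']
    exact (hasDerivAt_weight_mul_ev C η w c M2 A B φ p s).mul_const (F φ)
  have hG_meas : ∀ s : ℝ, AEStronglyMeasurable (G s) (volume : Measure (Cfg P j N)) := fun s =>
    (((continuous_weight C η w c M2 _).mul (continuous_ev C η _ p)).mul hFcont).aestronglyMeasurable
  have hG'_meas : AEStronglyMeasurable (G' 0) (volume : Measure (Cfg P j N)) :=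
    (((continuous_weight C η w c M2 _).mul (continuous_ev C η _ _)).mul hFcont).aestronglyMeasurable
  have hG_int : Integrable (G 0) (volume : Measure (Cfg P j N)) := by
    refine ((integrable_explin_mul_gauss (P := P) (j := j) (N := N) ((d₀ : ℝ) + |κ|) ha).const_mul
      (K₀ * K)).mono' (hG_meas 0) (Filter.Eventually.of_forall fun φ => ?_)
    have hWpos := weight_pos (C := C) (η := η) (w := w) (c := c) (M2 := M2) (A + (0 : ℝ) • B) φ
    have e3 : ‖G 0 φ‖ = weight C η w c M2 (A + (0 : ℝ) • B) φ * |ev C η (A + (0 : ℝ) • B) φ p| * |F φ| := by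
      simp only [hG, Real.norm_eq_abs, abs_mul, abs_of_pos hWpos]
    rw [e3]
    calc weight C η w c M2 (A + (0 : ℝ) • B) φ * |ev C η (A + (0 : ℝ) • B) φ p| * |F φ|
        ≤ Real.exp (-a * ∑ x : Site P j, ‖φ x‖ ^ 2) * (K₀ * (1 + ‖φ‖) ^ d₀) * (K * Real.exp (|κ| * ‖φ‖)) :=
          mul_le_mul (mul_le_mul (hwt 0 φ) (hb₀ _ φ) (abs_nonneg _) (Real.exp_pos _).le) (hK' φ) (abs_nonneg _)
            (by positivity)
      _ = (K₀ * K) * (((1 + ‖φ‖) ^ d₀ * Real.exp (|κ| * ‖φ‖)) * Real.exp (-a * ∑ x : Site P j, ‖φ x‖ ^ 2)) := by ring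
      _ ≤ (K₀ * K) * (Real.exp (((d₀ : ℝ) + |κ|) * ‖φ‖) * Real.exp (-a * ∑ x : Site P j, ‖φ x‖ ^ 2)) :=
          mul_le_mul_of_nonneg_left (mul_le_mul_of_nonneg_right (hgrow d₀ φ) (Real.exp_pos _).le) (by positivity)
  -- differentiation under the integral sign, and `f' = 0` for the identically vanishing family
  have hD := (hasDerivAt_integral_of_dominated_loc_of_deriv_le (Metric.ball_mem_nhds (0 : ℝ) one_pos)
    (Filter.Eventually.of_forall hG_meas) hG_int hG'_meas h_bound hbound_int h_diff).2
  have hzero := B3Sect2StatementsPart2.deriv_eq_zero_of_invariant hconst hD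
  have hint : ∫ φ, G' 0 φ = ∫ φ, weight C η w c M2 A φ * (F φ * ev C η A φ (step C η w c B p)) := by
    refine integral_congr_ae (Filter.Eventually.of_forall fun φ => ?_)
    simp only [hG', zero_smul, add_zero]
    ring
  rw [hint] at hzero
  exact hzero

/-! ## §5 (2.24) differentiated to all orders in `A` -/

/-- THE INTEGRANDS OF ALL ORDERS: `Pseq λ [] = P_λ` (the (2.24)-pairing) and `Pseq λ (B :: Bs) = step B (Pseq λ Bs)` — the
integrand obtained by differentiating (2.24) successively in the directions listed (last differentiation first in the list).
[cite: Balaban1983Higgs3, p.431 L20 ("differentiating (2.24) to higher order in A")] -/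
def Pseq (lam : Site P j → ℝ) : List (VecField P j ℝ) → WTPoly P j
  | [] => pDA w c lam
  | B :: Bs => step C η w c B (Pseq lam Bs)

/-- `Pseq λ [] = P_λ`. [cite: Balaban1983Higgs3, (2.24) p.430] -/
@[simp] theorem Pseq_nil (lam : Site P j → ℝ) : Pseq C η w c lam [] = pDA w c lam := rfl

/-- `Pseq λ (B :: Bs) = step B (Pseq λ Bs)`. [cite: Balaban1983Higgs3, p.431 L20] -/
@[simp] theorem Pseq_cons (lam : Site P j → ℝ) (B : VecField P j ℝ) (Bs : List (VecField P j ℝ)) :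
    Pseq C η w c lam (B :: Bs) = step C η w c B (Pseq C η w c lam Bs) := rfl

/-- `n` differentiations in one direction: `Pseq λ [B,…,B] = (step B)ⁿ P_λ`. [cite: Balaban1983Higgs3, p.431 L20] -/
theorem Pseq_replicate (lam : Site P j → ℝ) (B : VecField P j ℝ) (n : ℕ) :
    Pseq C η w c lam (List.replicate n B) = (step C η w c B)^[n] (pDA w c lam) := by
  induction n with
  | zero => rfl
  | succ n ih => rw [List.replicate_succ, Pseq_cons, ih, Function.iterate_succ_apply']

/-- **`Pseq` IS THE ITERATED DIRECTIONAL DERIVATIVE of the (2.24) integrand**: for every background `A`,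
`d/ds|_{s=0} [e^{−½⟨φ,(−Δ_{A+sB}+M²)φ⟩}·ev_{A+sB}(Pseq λ Bs)(φ)] = e^{−½⟨φ,(−Δ_A+M²)φ⟩}·ev_A(Pseq λ (B :: Bs))(φ)`, and
`ev_A(Pseq λ [])(φ) = ⟨D^η_Aφ, ∂^ηλqU(A)φ⟩` (`ev_pDA`). [cite: Balaban1983Higgs3, p.431 L20] -/
theorem deriv_integrand_Pseq (A B : VecField P j ℝ) (φ : Cfg P j N) (lam : Site P j → ℝ) (Bs : List (VecField P j ℝ)) :
    deriv (fun s : ℝ => weight C η w c M2 (A + s • B) φ * ev C η (A + s • B) φ (Pseq C η w c lam Bs)) 0 =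
      weight C η w c M2 A φ * ev C η A φ (Pseq C η w c lam (B :: Bs)) := by
  rw [(hasDerivAt_weight_mul_ev C η w c M2 A B φ (Pseq C η w c lam Bs) 0).deriv, Pseq_cons, zero_smul, add_zero]

/-- **(2.24) DIFFERENTIATED TO ALL ORDERS IN `A`** (p. 431: *"differentiating (2.24) to higher order in A, we can get all necessary
Ward-Takahashi identities"*), ON THE CONCRETE LATTICE MODEL: for every list of directions `B₁,…,Bₙ` of the vector field, every
background `A`, every gauge function `λ` and every continuous gauge-invariant `F` of exponential-linear growth,
`∫dφ e^{−½⟨φ,(−Δ^η_A+M²)φ⟩} F(φ)·ev_A(Pseq λ [Bₙ,…,B₁])(φ) = 0`,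
where `Pseq λ [Bₙ,…,B₁]` is the integrand obtained from `⟨D^η_Aφ, ∂^ηλqU(A)φ⟩` by `n` successive differentiations in `A`
(`deriv_integrand_Pseq`), an explicit polynomial in the bond atoms `⟪φ(b₋), q^mU(A_b)φ(b₊)⟫` (recursion `step`: each differentiation
inserts the current `−cηe⟨D_Aφ,B_iqU(A)φ⟩` or raises a `q`-power with the factor `ηeB_i`).  Hypotheses `η^d = w > 0`, `M² > 0`,
`cηe ≠ 0`.  Proof: induction on `n` — order `0` is (2.24) (`B3WT224Instance.eq224`), and each further order is one dominated
differentiation at `s = 0` of the identically vanishing family along `A + sB` (`integral_step_eq_zero`).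
[cite: Balaban1983Higgs3, (2.24) p.430; p.431 L20] -/
theorem eq224_allOrders (hw : 0 < w) (hM : 0 < M2) (hce : c * η * C.e ≠ 0) (lam : Site P j → ℝ) (F : Cfg P j N → ℝ)
    (hFinv : ∀ (lam' : Site P j → ℝ) (φ : Cfg P j N), F (rot C η c lam' φ) = F φ) (hFcont : Continuous F)
    (hFgr : ∃ K κ : ℝ, ∀ φ, |F φ| ≤ K * Real.exp (κ * ‖φ‖)) (Bs : List (VecField P j ℝ)) (A : VecField P j ℝ) :
    ∫ φ, weight C η w c M2 A φ * (F φ * ev C η A φ (Pseq C η w c lam Bs)) = 0 := by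
  induction Bs generalizing A with
  | nil =>
    simp only [Pseq_nil, ev_pDA]
    exact eq224 C η w c M2 hw hM hce A lam F hFinv hFcont hFgr
  | cons B Bs ih =>
    rw [Pseq_cons]
    exact integral_step_eq_zero C η w c M2 hw hM F hFcont hFgr (Pseq C η w c lam Bs) ih A B

/-- the identities of all orders **at `A = 0`** (print: *"next taking A = 0"*), where the atoms are `⟪φ(b₋), q^mφ(b₊)⟫` and the weight
is `e^{−½⟨φ,(−Δ^η+M²)φ⟩}`. [cite: Balaban1983Higgs3, (2.26) p.431; p.431 L20] -/
theorem eq224_allOrders_zero (hw : 0 < w) (hM : 0 < M2) (hce : c * η * C.e ≠ 0) (lam : Site P j → ℝ) (F : Cfg P j N → ℝ)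
    (hFinv : ∀ (lam' : Site P j → ℝ) (φ : Cfg P j N), F (rot C η c lam' φ) = F φ) (hFcont : Continuous F)
    (hFgr : ∃ K κ : ℝ, ∀ φ, |F φ| ≤ K * Real.exp (κ * ‖φ‖)) (Bs : List (VecField P j ℝ)) :
    ∫ φ, weight C η w c M2 (0 : VecField P j ℝ) φ * (F φ * ev C η (0 : VecField P j ℝ) φ (Pseq C η w c lam Bs)) = 0 :=
  eq224_allOrders C η w c M2 hw hM hce lam F hFinv hFcont hFgr Bs 0

/-- the same as a normalized Gaussian expectation: `Z⁻¹∫dφ e^{−½⟨φ,(−Δ^η+M²)φ⟩}F(φ)ev_0(Pseq λ Bs)(φ) = 0`, i.e.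
`∫dμ_{C^η_{M²}} F·(Pseq λ Bs) = 0`. [cite: Balaban1983Higgs3, (2.26) p.431; p.431 L20] -/
theorem eq224_allOrders_mean (hw : 0 < w) (hM : 0 < M2) (hce : c * η * C.e ≠ 0) (lam : Site P j → ℝ) (F : Cfg P j N → ℝ)
    (hFinv : ∀ (lam' : Site P j → ℝ) (φ : Cfg P j N), F (rot C η c lam' φ) = F φ) (hFcont : Continuous F)
    (hFgr : ∃ K κ : ℝ, ∀ φ, |F φ| ≤ K * Real.exp (κ * ‖φ‖)) (Bs : List (VecField P j ℝ)) :
    (∫ φ, weight C η w c M2 (0 : VecField P j ℝ) φ * (F φ * ev C η (0 : VecField P j ℝ) φ (Pseq C η w c lam Bs))) /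
      ∫ φ, weight C η w c M2 (0 : VecField P j ℝ) φ = 0 := by
  rw [eq224_allOrders_zero C η w c M2 hw hM hce lam F hFinv hFcont hFgr Bs, zero_div]

/-- **the n-th `A`-derivative of (2.24) in one direction**: for every direction `B`, background `A`, `n ∈ ℕ`,
`∫dφ (dⁿ/dsⁿ|_{s=0} [e^{−½⟨φ,(−Δ^η_{A+sB}+M²)φ⟩}⟨D^η_{A+sB}φ, ∂^ηλqU(A+sB)φ⟩])·F(φ) = 0` — the literal reading of
*"differentiating (2.24) to higher order in A"* (the derivative taken under the integral sign, which §4 justifies).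
[cite: Balaban1983Higgs3, (2.24) p.430; p.431 L20] -/
theorem eq224_iteratedDeriv (hw : 0 < w) (hM : 0 < M2) (hce : c * η * C.e ≠ 0) (B : VecField P j ℝ) (lam : Site P j → ℝ)
    (F : Cfg P j N → ℝ) (hFinv : ∀ (lam' : Site P j → ℝ) (φ : Cfg P j N), F (rot C η c lam' φ) = F φ)
    (hFcont : Continuous F) (hFgr : ∃ K κ : ℝ, ∀ φ, |F φ| ≤ K * Real.exp (κ * ‖φ‖)) (n : ℕ) (A : VecField P j ℝ) :
    ∫ φ, iteratedDeriv n (fun s : ℝ => weight C η w c M2 (A + s • B) φ * pairDA C η w c (A + s • B) lam φ) 0 * F φ = 0 := by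
  have key : ∀ φ : Cfg P j N,
      iteratedDeriv n (fun s : ℝ => weight C η w c M2 (A + s • B) φ * pairDA C η w c (A + s • B) lam φ) 0 =
        weight C η w c M2 A φ * ev C η A φ (Pseq C η w c lam (List.replicate n B)) := fun φ => by
    have h := iteratedDeriv_weight_mul_ev C η w c M2 A B φ (pDA w c lam) n
    simp only [ev_pDA] at h
    rw [h, Pseq_replicate]
    simp only [zero_smul, add_zero]
  simp_rw [key]
  have h := eq224_allOrders C η w c M2 hw hM hce lam F hFinv hFcont hFgr (List.replicate n B) A
  rw [← h]
  exact integral_congr_ae (Filter.Eventually.of_forall fun φ => by ring)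

/-- … and **at `A = 0`**: `∫dφ (dⁿ/dsⁿ|_{s=0} [e^{−½⟨φ,(−Δ^η_{sB}+M²)φ⟩}⟨D^η_{sB}φ, ∂^ηλqU(sB)φ⟩])·F(φ) = 0` for every `n`
(`n = 1`: (2.26)/(2.28), `B3WT226Derivative.eq226_deriv`/`B3WT228Left.eq226F_deriv`).
[cite: Balaban1983Higgs3, (2.26) p.431; p.431 L20] -/
theorem eq224_iteratedDeriv_zero (hw : 0 < w) (hM : 0 < M2) (hce : c * η * C.e ≠ 0) (B : VecField P j ℝ)
    (lam : Site P j → ℝ) (F : Cfg P j N → ℝ) (hFinv : ∀ (lam' : Site P j → ℝ) (φ : Cfg P j N), F (rot C η c lam' φ) = F φ)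
    (hFcont : Continuous F) (hFgr : ∃ K κ : ℝ, ∀ φ, |F φ| ≤ K * Real.exp (κ * ‖φ‖)) (n : ℕ) :
    ∫ φ, iteratedDeriv n (fun s : ℝ => weight C η w c M2 (s • B) φ * pairDA C η w c (s • B) lam φ) 0 * F φ = 0 := by
  have h := eq224_iteratedDeriv C η w c M2 hw hM hce B lam F hFinv hFcont hFgr n 0
  simpa only [zero_add] using h

/-! ## §6 Order one is (2.26)/(2.28) -/

/-- **the differentiated (2.24)-pairing**: `ev_A(DB B P_λ)(φ) = pairDAdot(A,B,λ,φ)` — the derivation reproduces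
`B3WT226Pairings.pairDAdot` (both slots of `⟨D_Aφ, ∂λqU(A)φ⟩` differentiated; `⟪qu,qu⟫ = −⟪u,q²u⟫`).
[cite: Balaban1983Higgs3, (2.26) p.431] -/
theorem ev_DB_pDA (A B : VecField P j ℝ) (lam : Site P j → ℝ) (φ : Cfg P j N) :
    ev C η A φ (DB C η B (pDA w c lam)) = pairDAdot C η w c A B lam φ := by
  rw [pDA, pJ, DB_cur, ev_cur, pairDAdot]
  refine Finset.sum_congr rfl fun b _ => ?_
  set u := C.U η (A b) (φ b.tgt) with hu
  have h1 := inner_q_q_self C u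
  have h2 : (C.q ^ (1 + 1)) u = C.q (C.q u) := by rw [qpow_succ_apply, pow_one]
  simp only [covDerivScalar, HiggsLattice.ChargeData.Urep_apply, map_smul, real_inner_smul_left, real_inner_smul_right,
    inner_sub_left, h2]
  rw [← hu, h1]
  ring

/-- **the order-one integrand**: `ev_A(step B P_λ)(φ) = −cηe⟨D_Aφ,BqU(A)φ⟩⟨D_Aφ,∂λqU(A)φ⟩ + pairDAdot(A,B,λ,φ)` — exactly the
`s`-derivative computed in `B3WT226Derivative.eq226_deriv`/`B3WT228Left.eq226F_deriv`. [cite: Balaban1983Higgs3, (2.26) p.431] -/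
theorem ev_step_pDA (A B : VecField P j ℝ) (lam : Site P j → ℝ) (φ : Cfg P j N) :
    ev C η A φ (step C η w c B (pDA w c lam)) =
      -(c * η * C.e) * pairJ C η w c A B φ * pairDA C η w c A lam φ + pairDAdot C η w c A B lam φ := by
  rw [ev_step, ev_pDA, ev_DB_pDA]

/-- **at `A = 0` the order-one integrand is LETTER FOR LETTER the integrand of (2.26)/(2.28)** (`B3WT228Left.eq226F_deriv`):
`ev_0(step B P_λ)(φ) = (−cηe⟨∂^ηφ,Bqφ⟩)⟨∂^ηφ,∂^ηλqφ⟩ − cηe⟨φ,B·∂^ηλq²φ⟩ − ηe⟨∂^ηφ,B∂^ηλq²φ⟩` (`pairJ_zero`, `pairDA_zero`,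
`pairDAdot_zero`); hence `eq224_allOrders_zero … [B]`, rewritten with this lemma, is exactly `B3WT228Left.eq226F_deriv` (not
restated here: the landed declaration is the one to cite). [cite: Balaban1983Higgs3, (2.26) p.431; (2.28) p.431] -/
theorem ev_step_pDA_zero (B : VecField P j ℝ) (lam : Site P j → ℝ) (φ : Cfg P j N) :
    ev C η (0 : VecField P j ℝ) φ (step C η w c B (pDA w c lam)) =
      (-(c * η * C.e) * curJ C w c B φ) * pairD C w c lam φ - (c * η * C.e) * locQ C w c B lam φ
        - (η * C.e) * derQ C w c B lam φ := by
  rw [ev_step_pDA, pairJ_zero, pairDA_zero, pairDAdot_zero]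
  ring

/-! ## §7 Order two written out -/

/-- `J_B = cur 1 B`. [cite: Balaban1983Higgs3, (2.26) p.431] -/
theorem pJ_eq_cur (B : VecField P j ℝ) : pJ w c B = cur w c 1 B := rfl

/-- `P_λ = cur 1 (∂^ηλ)`. [cite: Balaban1983Higgs3, (2.24) p.430] -/
theorem pDA_eq_cur (lam : Site P j → ℝ) : pDA w c lam = cur w c 1 (grad c lam) := rfl

/-- **THE SECOND-ORDER INTEGRAND, written out** (the first identity the print leaves to *"higher order in A"*): with
`J_i = cur 1 B_i`, `P = cur 1 ∂^ηλ`, `P⁽ⁱ⁾ = cur 2 (ηeB_i·∂^ηλ)`, `J₁⁽²⁾ = cur 2 (ηeB₂·B₁)`, `P⁽¹²⁾ = cur 3 (ηeB₂·ηeB₁·∂^ηλ)`,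
`Pseq λ [B₂,B₁] = (cηe)²J₂J₁P − cηe(J₂P⁽¹⁾ + J₁⁽²⁾P + J₁P⁽²⁾) + P⁽¹²⁾` — two current insertions; one insertion and one `q`-raising
(three ways); two `q`-raisings. [cite: Balaban1983Higgs3, p.431 L20 ("differentiating (2.24) to higher order in A")] -/
theorem Pseq_two (lam : Site P j → ℝ) (B₁ B₂ : VecField P j ℝ) :
    Pseq C η w c lam [B₂, B₁] =
      MvPolynomial.C ((c * η * C.e) ^ 2) * cur w c 1 B₂ * cur w c 1 B₁ * cur w c 1 (grad c lam)
      + MvPolynomial.C (-(c * η * C.e)) *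
        (cur w c 1 B₂ * cur w c 2 (fun b => η * C.e * B₁ b * grad c lam b)
          + cur w c 2 (fun b => η * C.e * B₂ b * B₁ b) * cur w c 1 (grad c lam)
          + cur w c 1 B₁ * cur w c 2 (fun b => η * C.e * B₂ b * grad c lam b))
      + cur w c 3 (fun b => η * C.e * B₂ b * (η * C.e * B₁ b * grad c lam b)) := by
  simp only [Pseq_cons, Pseq_nil, step, pJ_eq_cur, pDA_eq_cur, map_add, map_neg, Derivation.leibniz, smul_eq_mul, DB_cur,
    DB_C, map_pow]
  ring

/-- **THE SECOND-ORDER WARD–TAKAHASHI IDENTITY AT `A = 0`, EXPLICIT** — (2.24) differentiated twice, in the directions `B₁` then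
`B₂`, at `A = 0`, in the presence of `F`: writing `S_m(a)(φ) := −Σ_b η^d c a_b⟪φ(b₋), q^mφ(b₊)⟫` (so `S₁(B) = ⟨∂^ηφ,Bqφ⟩ = curJ`),
`∫dφ e^{−½⟨φ,(−Δ^η+M²)φ⟩}F(φ)·[(cηe)²S₁(B₂)S₁(B₁)S₁(∂λ) − cηe(S₁(B₂)S₂(ηeB₁∂λ) + S₂(ηeB₂B₁)S₁(∂λ) + S₁(B₁)S₂(ηeB₂∂λ))
 + S₃(ηeB₂·ηeB₁·∂λ)](φ) = 0` — a three-current identity with its contact terms (`η^d = w > 0`, `M² > 0`, `cηe ≠ 0`).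
[cite: Balaban1983Higgs3, p.431 L20 ("differentiating (2.24) to higher order in A")] -/
theorem eq224_secondOrder_zero (hw : 0 < w) (hM : 0 < M2) (hce : c * η * C.e ≠ 0) (B₁ B₂ : VecField P j ℝ)
    (lam : Site P j → ℝ) (F : Cfg P j N → ℝ) (hFinv : ∀ (lam' : Site P j → ℝ) (φ : Cfg P j N), F (rot C η c lam' φ) = F φ)
    (hFcont : Continuous F) (hFgr : ∃ K κ : ℝ, ∀ φ, |F φ| ≤ K * Real.exp (κ * ‖φ‖)) :
    ∫ φ, weight C η w c M2 (0 : VecField P j ℝ) φ * (F φ *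
      ((c * η * C.e) ^ 2 * (∑ b : PBond P j, -(w * c * B₂ b) * ⟪φ b.src, (C.q ^ 1) (φ b.tgt)⟫_ℝ)
          * (∑ b : PBond P j, -(w * c * B₁ b) * ⟪φ b.src, (C.q ^ 1) (φ b.tgt)⟫_ℝ)
          * (∑ b : PBond P j, -(w * c * grad c lam b) * ⟪φ b.src, (C.q ^ 1) (φ b.tgt)⟫_ℝ)
        + -(c * η * C.e) *
          ((∑ b : PBond P j, -(w * c * B₂ b) * ⟪φ b.src, (C.q ^ 1) (φ b.tgt)⟫_ℝ)
              * (∑ b : PBond P j, -(w * c * (η * C.e * B₁ b * grad c lam b)) * ⟪φ b.src, (C.q ^ 2) (φ b.tgt)⟫_ℝ)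
            + (∑ b : PBond P j, -(w * c * (η * C.e * B₂ b * B₁ b)) * ⟪φ b.src, (C.q ^ 2) (φ b.tgt)⟫_ℝ)
              * (∑ b : PBond P j, -(w * c * grad c lam b) * ⟪φ b.src, (C.q ^ 1) (φ b.tgt)⟫_ℝ)
            + (∑ b : PBond P j, -(w * c * B₁ b) * ⟪φ b.src, (C.q ^ 1) (φ b.tgt)⟫_ℝ)
              * (∑ b : PBond P j, -(w * c * (η * C.e * B₂ b * grad c lam b)) * ⟪φ b.src, (C.q ^ 2) (φ b.tgt)⟫_ℝ))
        + ∑ b : PBond P j, -(w * c * (η * C.e * B₂ b * (η * C.e * B₁ b * grad c lam b))) *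
            ⟪φ b.src, (C.q ^ 3) (φ b.tgt)⟫_ℝ)) = 0 := by
  have h := eq224_allOrders_zero C η w c M2 hw hM hce lam F hFinv hFcont hFgr [B₂, B₁]
  simpa only [Pseq_two, ev_add, ev_mul, ev_C, ev_cur_zero] using h

/-- `S₁(B)(φ) = −Σ_b η^d c B_b⟪φ(b₋), qφ(b₊)⟫ = ⟨∂^ηφ, Bqφ⟩ = curJ` — the order-one current of (2.26) in the bond-sum form of §7
(`⟪φ(b₊), qφ(b₊)⟫ = 0`). [cite: Balaban1983Higgs3, (2.26) p.431] -/
theorem curJ_eq_bondSum (B : VecField P j ℝ) (φ : Cfg P j N) :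
    curJ C w c B φ = ∑ b : PBond P j, -(w * c * B b) * ⟪φ b.src, (C.q ^ 1) (φ b.tgt)⟫_ℝ := by
  unfold curJ
  refine Finset.sum_congr rfl fun b _ => ?_
  have h0 := inner_q_self C (φ b.tgt)
  have hg : grad c φ b = c • (φ b.tgt - φ b.src) := rfl
  rw [hg, pow_one]
  simp only [real_inner_smul_left, real_inner_smul_right, inner_sub_left]
  rw [h0]
  ring

end Literature.MathematicalPhysics.QuantumFieldTheory.Balaban1983to89.B3WT224HigherOrder

end
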